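import Literature.Geometry.Lorentzian.HypersurfaceCorrespondingBoundary
import HarnessLib

/-!
# No corresponding boundary points for a realised region containing the compact-shadow points

The SHADOW FORM of `LorentzianMetric.false_of_corresponding`
(`HypersurfaceCorrespondingBoundary`). Setting as there: two time-oriented Lorentzian manifolds
`M₁`, `M₂`; a Cauchy hypersurface `S₁` of `M₁` and an open `U ⊇ S₁` in which `S₁` is a Cauchy
hypersurface; an ACHRONAL `S ⊆ M₂` and an open `W ⊆ M₂` in which `S` is a Cauchy hypersurface;
`ψ : M₁ → M₂` continuous, injective and open on `U`, `ψ(S₁) = S`, `ψ(U) = W`, transporting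
timelike segments. The proof of the future case of `false_of_corresponding` shows first that the
image point `p'` of a corresponding pair `(p, p')`, `p ∈ ∂U ∩ I⁺(S₁)`, lies in `I⁺(S)` and has a
**compact shadow**: `I⁻(p') ∩ S ⊆ C` for a compact `C ⊆ S` (the image of `J⁻(p⁺) ∩ S₁`,
`p ≪ p⁺`); it then invokes the horizon lemma (every past-endless causal curve from `p'` meets `S`)
and the domain-of-dependence hypothesis (hD⁺) to place `p'` in `W`. Here the last two steps are
replaced by the single hypothesis

* **(hDsh⁺) every `q ∈ I⁺(S)` whose shadow `I⁻(q) ∩ S` is contained in a compact subset of `S`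
  lies in `W`** (and its time dual (hDsh⁻)),

so that the horismos conditions `J±(S) ⊆ S ∪ I±(S)`, the non-imprisonment of endless causal
curves and the compactness of `J⁺(C) ∩ J⁻(x)` are no longer needed:
`false_of_corresponding_shadow_future`, `false_of_corresponding_shadow_past` (time dual),
`false_of_corresponding_shadow`. The point of the reformulation: (hDsh±) is met by a region `W`
built as a UNION of sets `I⁻(x) ∩ I⁺(S)` over compact-shadow points `x` (an open set by
construction), whereas (hD±) asks `W` to contain the causal domain of dependence of `S`, whose
openness (O'Neill 1983, Lemma 14.43) rests on limit-curve arguments.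

Everything is proved; no definitions, no named facts. Consumer: the hypersurface sub-data
maximality statement of summit `FinalStateConjecture` (`stub_hypersurfaceMGHDRealised`, crux
`CaptureSufficesC2`), shadow route.

## References

* J. Sbierski, Ann. Henri Poincaré 17 (2016) 301–329 = arXiv:1309.7591v3, §3.2, Def. 11,
  Prop. 13 (arXiv numbering). [Sbierski2016AHP]
* S. W. Hawking, G. F. R. Ellis, *The large scale structure of space-time*, CUP 1973, §6.5–6.6,
  §7.6 pp. 249–251. [HawkingEllis1973CUP]
* B. O'Neill, *Semi-Riemannian geometry with applications to relativity*, Academic Press 1983,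
  Ch. 14, Def. 14.35, Lemma 14.42–14.43. [ONeillSemiRiemannian1983]
-/

noncomputable section

open Set Filter Function TopologicalSpace Topology
open scoped Manifold ContDiff Topology

namespace Literature.Geometry.Lorentzian

namespace LorentzianMetric

section Core

variable {E₁ : Type*} [NormedAddCommGroup E₁] [NormedSpace ℝ E₁] {H₁ : Type*} [TopologicalSpace H₁]
  {I₁ : ModelWithCorners ℝ E₁ H₁} {n₁ : ℕ∞ω} {M₁ : Type*} [TopologicalSpace M₁] [ChartedSpace H₁ M₁]
  [IsManifold I₁ ∞ M₁] [T2Space M₁] [SecondCountableTopology M₁] [BoundarylessManifold I₁ M₁]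
  [FiniteDimensional ℝ E₁] {g₁ : LorentzianMetric I₁ n₁ M₁} {τ₁ : TimeOrientation g₁}
  {E₂ : Type*} [NormedAddCommGroup E₂] [NormedSpace ℝ E₂] {H₂ : Type*} [TopologicalSpace H₂]
  {I₂ : ModelWithCorners ℝ E₂ H₂} {n₂ : ℕ∞ω} {M₂ : Type*} [TopologicalSpace M₂] [ChartedSpace H₂ M₂]
  [IsManifold I₂ ∞ M₂] [T2Space M₂] [SecondCountableTopology M₂] [BoundarylessManifold I₂ M₂]
  [FiniteDimensional ℝ E₂] {g₂ : LorentzianMetric I₂ n₂ M₂} {τ₂ : TimeOrientation g₂}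

/-- **Future case, shadow form: no corresponding pair with `p ∈ ∂U ∩ I⁺(S₁)`**, when `W`
contains every point of `I⁺(S)` with compact shadow on `S` (hDsh⁺). As in
`false_of_corresponding_future`: `p' ∈ I⁺(ψ r) ⊆ I⁺(S)` for some `r ∈ U` below `p`, and the
shadow bound `I⁻(p') ∩ S ⊆ ψ(J⁻(p⁺) ∩ S₁)` (compact, inside `S`) puts `p'` in `W = ψ(U)`,
which is absurd for an injective open `ψ` and `p ∈ ∂U`.
[cite: HawkingEllis1973CUP, §7.6, pp. 249–251] [cite: Sbierski2016AHP, §3.2, Prop. 13 (arXiv numbering)] -/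
theorem false_of_corresponding_shadow_future (hn₁ : 2 ≤ n₁) (hn₂ : 2 ≤ n₂)
    (hres₁ : PseudoRiemannianMetric.contMDiff_restrict (I := I₁) (n := n₁) (M := M₁))
    (hτ₁ : τ₁.contMDiff_restrict)
    (hres₂ : PseudoRiemannianMetric.contMDiff_restrict (I := I₂) (n := n₂) (M := M₂))
    (hτ₂ : τ₂.contMDiff_restrict)
    {S₁ : Set M₁} (hS₁ : g₁.IsCauchyHypersurface τ₁ S₁) {U : Opens M₁} (hS₁U : S₁ ⊆ U)
    (hU : (g₁.restrict hres₁ U).IsCauchyHypersurface (τ₁.restrict hres₁ hτ₁ U) (Subtype.val ⁻¹' S₁))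
    {S : Set M₂} (hA : g₂.IsAchronal τ₂ S) {W : Opens M₂}
    (hW : (g₂.restrict hres₂ W).IsCauchyHypersurface (τ₂.restrict hres₂ hτ₂ W) (Subtype.val ⁻¹' S))
    {ψ : M₁ → M₂} (hψW : MapsTo ψ U W) (hWψ : (W : Set M₂) ⊆ ψ '' U) (hψc : ContinuousOn ψ U)
    (hinj : InjOn ψ U) (hopen : ∀ B : Set M₁, IsOpen B → IsOpen (ψ '' (B ∩ U)))
    (hψS : ψ '' S₁ = S)
    (hpush : ∀ ⦃γ : ℝ → M₁⦄ ⦃a b : ℝ⦄, a < b → g₁.IsFutureTimelikeCurveOn τ₁ γ (Icc a b) →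
      (∀ t ∈ Icc a b, γ t ∈ U) → ψ (γ b) ∈ g₂.chronologicalFuture τ₂ {ψ (γ a)})
    (hpull : ∀ ⦃γ : ℝ → M₂⦄ ⦃a b : ℝ⦄, a < b → g₂.IsFutureTimelikeCurveOn τ₂ γ (Icc a b) →
      (∀ t ∈ Icc a b, γ t ∈ W) → ∀ ⦃x y : M₁⦄, x ∈ U → y ∈ U → γ a = ψ x → γ b = ψ y →
      y ∈ g₁.chronologicalFuture τ₁ {x})
    (hK₁ : ∀ x : M₁, IsCompact (g₁.causalPast τ₁ {x} ∩ g₁.causalFuture τ₁ S₁))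
    (hrel₂ : ∀ {xs ys : ℕ → M₂} {x y : M₂}, Tendsto xs atTop (𝓝 x) → Tendsto ys atTop (𝓝 y) →
      (∀ j, ys j ∈ g₂.causalFuture τ₂ {xs j}) → y ∈ g₂.causalFuture τ₂ {x})
    (hDsh : ∀ q ∈ g₂.chronologicalFuture τ₂ S,
      (∃ C : Set M₂, C ⊆ S ∧ IsCompact C ∧ g₂.chronologicalPast τ₂ {q} ∩ S ⊆ C) → q ∈ W)
    {p : M₁} (hp : p ∈ frontier (U : Set M₁)) (hpI : p ∈ g₁.chronologicalFuture τ₁ S₁) {p' : M₂}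
    (hcorr : ∀ V ∈ 𝓝 p, ∀ V' ∈ 𝓝 p', ∃ y ∈ (U : Set M₁), y ∈ V ∧ ψ y ∈ V') : False := by
  haveI : LocallyCompactSpace M₁ := Manifold.locallyCompact_of_finiteDimensional (M := M₁) I₁
  have hn2' : (1 : ℕ∞ω) ≤ n₂ := le_trans one_le_two hn₂
  -- points below `p` and `p' ∈ I⁺(S)`
  obtain ⟨r, r₁, hrU, hr₁U, hrI, hrr₁, hpr₁⟩ := exists_mem_opens_ll_ll hn₁ hres₁ hτ₁ hS₁ hU hp hpI
  have hle : p' ∈ g₂.causalFuture τ₂ {ψ r₁} :=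
    mem_causalFuture_glue_of_corresponding hn₁ hres₁ hτ₁ hS₁ hU hpush hrel₂ hcorr hr₁U hpr₁
  have hll : ψ r₁ ∈ g₂.chronologicalFuture τ₂ {ψ r} :=
    glue_mem_chronologicalFuture_of_mem hn₁ hres₁ hτ₁ hS₁ hU hpush hrU hr₁U hrr₁
  have h1 : p' ∈ g₂.chronologicalFuture τ₂ {ψ r} :=
    mem_chronologicalFuture_of_mem_chronologicalFuture_of_mem_causalFuture hn2' hll hle
  have h2 : ψ r ∈ g₂.chronologicalFuture τ₂ S := by
    have h := hrI
    rw [chronologicalFuture_eq_biUnion] at h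
    simp only [mem_iUnion, exists_prop] at h
    obtain ⟨s, hsS, hrs⟩ := h
    have hψs : ψ s ∈ S := by rw [← hψS]; exact mem_image_of_mem ψ hsS
    have h3 : ψ r ∈ g₂.chronologicalFuture τ₂ {ψ s} :=
      glue_mem_chronologicalFuture_of_mem hn₁ hres₁ hτ₁ hS₁ hU hpush (hS₁U hsS) hrU hrs
    exact chronologicalFuture_mono (singleton_subset_iff.2 hψs) h3
  have h3 : p' ∈ g₂.chronologicalFuture τ₂ S := mem_chronologicalFuture_trans h2 h1
  -- the compact shadow
  obtain ⟨pf, hpf⟩ := exists_mem_chronologicalFuture_singleton (g := g₁) (τ := τ₁) hn₁ p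
  set C : Set M₂ := ψ '' (g₁.causalPast τ₁ {pf} ∩ S₁) with hC
  have hCc : IsCompact C := isCompact_image_causalPast_inter hn₁ hS₁ hS₁U hK₁ hψc pf
  have hCS : C ⊆ S := by
    rintro _ ⟨s, hs, rfl⟩
    rw [← hψS]
    exact mem_image_of_mem ψ hs.2
  have hshadow : g₂.chronologicalPast τ₂ {p'} ∩ S ⊆ C :=
    chronologicalPast_inter_subset_image_of_corresponding_hyp hn₂ hres₂ hτ₂ hS₁U hA hW hψW hψS
      hpull hpf hcorr
  -- `p' ∈ W` by (hDsh⁺)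
  have hp'W : p' ∈ W := hDsh p' h3 ⟨C, hCS, hCc, hshadow⟩
  obtain ⟨y₀, hy₀U, hy₀⟩ := hWψ hp'W
  refine false_of_mem_image_of_corresponding U.2 hinj hopen hp hy₀U ?_
  rw [hy₀]
  exact fun V hV V' hV' ↦ hcorr V hV V' hV'

/-- **Past case, shadow form** — the future case for the reversed time orientations: Cauchy
hypersurfaces, achronality, the transport hypotheses and the closedness of `≤` are self-dual,
`I±` and the two halves of (hDsh) are exchanged. O'Neill 1983, Ch. 14, p. 402 (time duality).
[cite: HawkingEllis1973CUP, §7.6, pp. 249–251] [cite: ONeillSemiRiemannian1983, Ch. 14, p. 402] -/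
theorem false_of_corresponding_shadow_past (hn₁ : 2 ≤ n₁) (hn₂ : 2 ≤ n₂)
    (hres₁ : PseudoRiemannianMetric.contMDiff_restrict (I := I₁) (n := n₁) (M := M₁))
    (hτ₁ : τ₁.contMDiff_restrict)
    (hres₂ : PseudoRiemannianMetric.contMDiff_restrict (I := I₂) (n := n₂) (M := M₂))
    (hτ₂ : τ₂.contMDiff_restrict)
    {S₁ : Set M₁} (hS₁ : g₁.IsCauchyHypersurface τ₁ S₁) {U : Opens M₁} (hS₁U : S₁ ⊆ U)
    (hU : (g₁.restrict hres₁ U).IsCauchyHypersurface (τ₁.restrict hres₁ hτ₁ U) (Subtype.val ⁻¹' S₁))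
    {S : Set M₂} (hA : g₂.IsAchronal τ₂ S) {W : Opens M₂}
    (hW : (g₂.restrict hres₂ W).IsCauchyHypersurface (τ₂.restrict hres₂ hτ₂ W) (Subtype.val ⁻¹' S))
    {ψ : M₁ → M₂} (hψW : MapsTo ψ U W) (hWψ : (W : Set M₂) ⊆ ψ '' U) (hψc : ContinuousOn ψ U)
    (hinj : InjOn ψ U) (hopen : ∀ B : Set M₁, IsOpen B → IsOpen (ψ '' (B ∩ U)))
    (hψS : ψ '' S₁ = S)
    (hpush : ∀ ⦃γ : ℝ → M₁⦄ ⦃a b : ℝ⦄, a < b → g₁.IsFutureTimelikeCurveOn τ₁ γ (Icc a b) →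
      (∀ t ∈ Icc a b, γ t ∈ U) → ψ (γ b) ∈ g₂.chronologicalFuture τ₂ {ψ (γ a)})
    (hpull : ∀ ⦃γ : ℝ → M₂⦄ ⦃a b : ℝ⦄, a < b → g₂.IsFutureTimelikeCurveOn τ₂ γ (Icc a b) →
      (∀ t ∈ Icc a b, γ t ∈ W) → ∀ ⦃x y : M₁⦄, x ∈ U → y ∈ U → γ a = ψ x → γ b = ψ y →
      y ∈ g₁.chronologicalFuture τ₁ {x})
    (hK₁' : ∀ x : M₁, IsCompact (g₁.causalFuture τ₁ {x} ∩ g₁.causalPast τ₁ S₁))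
    (hrel₂ : ∀ {xs ys : ℕ → M₂} {x y : M₂}, Tendsto xs atTop (𝓝 x) → Tendsto ys atTop (𝓝 y) →
      (∀ j, ys j ∈ g₂.causalFuture τ₂ {xs j}) → y ∈ g₂.causalFuture τ₂ {x})
    (hDsh' : ∀ q ∈ g₂.chronologicalPast τ₂ S,
      (∃ C : Set M₂, C ⊆ S ∧ IsCompact C ∧ g₂.chronologicalFuture τ₂ {q} ∩ S ⊆ C) → q ∈ W)
    {p : M₁} (hp : p ∈ frontier (U : Set M₁)) (hpI : p ∈ g₁.chronologicalPast τ₁ S₁) {p' : M₂}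
    (hcorr : ∀ V ∈ 𝓝 p, ∀ V' ∈ 𝓝 p', ∃ y ∈ (U : Set M₁), y ∈ V ∧ ψ y ∈ V') : False := by
  have hτ₁' : τ₁.reverse.contMDiff_restrict := τ₁.contMDiff_restrict_reverse hτ₁
  have hτ₂' : τ₂.reverse.contMDiff_restrict := τ₂.contMDiff_restrict_reverse hτ₂
  have hU' : (g₁.restrict hres₁ U).IsCauchyHypersurface (τ₁.reverse.restrict hres₁ hτ₁' U)
      (Subtype.val ⁻¹' S₁) := by
    rw [← TimeOrientation.restrict_reverse]
    exact hU.reverse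
  have hW' : (g₂.restrict hres₂ W).IsCauchyHypersurface (τ₂.reverse.restrict hres₂ hτ₂' W)
      (Subtype.val ⁻¹' S) := by
    rw [← TimeOrientation.restrict_reverse]
    exact hW.reverse
  -- the transport hypotheses for the reversed orientations (reverse the parameter)
  have hpush' : ∀ ⦃γ : ℝ → M₁⦄ ⦃a b : ℝ⦄, a < b → g₁.IsFutureTimelikeCurveOn τ₁.reverse γ (Icc a b) →
      (∀ t ∈ Icc a b, γ t ∈ U) →
      ψ (γ b) ∈ g₂.chronologicalFuture τ₂.reverse {ψ (γ a)} := by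
    intro γ a b hab hγ hγU
    have hγ' : g₁.IsFutureTimelikeCurveOn τ₁ (fun t ↦ γ (a + b - t)) (Icc a b) :=
      isFutureTimelikeCurveOn_reverse_reverse_iff.1 hγ.reverseParam
    have hγU' : ∀ t ∈ Icc a b, γ (a + b - t) ∈ U := fun t ht ↦
      hγU (a + b - t) ⟨by linarith [ht.2], by linarith [ht.1]⟩
    have h := hpush hab hγ' hγU'
    have h' : ψ (γ (a + b - b)) ∈ g₂.chronologicalFuture τ₂ {ψ (γ (a + b - a))} := h
    rw [add_sub_cancel_right, add_sub_cancel_left] at h'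
    exact mem_chronologicalPast_of_mem_chronologicalFuture h'
  have hpull' : ∀ ⦃γ : ℝ → M₂⦄ ⦃a b : ℝ⦄, a < b → g₂.IsFutureTimelikeCurveOn τ₂.reverse γ (Icc a b) →
      (∀ t ∈ Icc a b, γ t ∈ W) → ∀ ⦃x y : M₁⦄, x ∈ U → y ∈ U → γ a = ψ x → γ b = ψ y →
      y ∈ g₁.chronologicalFuture τ₁.reverse {x} := by
    intro γ a b hab hγ hγW x y hx hy hγa hγb
    have hγ' : g₂.IsFutureTimelikeCurveOn τ₂ (fun t ↦ γ (a + b - t)) (Icc a b) :=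
      isFutureTimelikeCurveOn_reverse_reverse_iff.1 hγ.reverseParam
    have hγW' : ∀ t ∈ Icc a b, γ (a + b - t) ∈ W := fun t ht ↦
      hγW (a + b - t) ⟨by linarith [ht.2], by linarith [ht.1]⟩
    have h := hpull hab hγ' hγW' hy hx (by show γ (a + b - a) = ψ y; rw [add_sub_cancel_left]; exact hγb)
      (by show γ (a + b - b) = ψ x; rw [add_sub_cancel_right]; exact hγa)
    exact mem_chronologicalPast_of_mem_chronologicalFuture h
  have hK₁'' : ∀ x : M₁, IsCompact (g₁.causalPast τ₁.reverse {x} ∩ g₁.causalFuture τ₁.reverse S₁) :=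
    fun x ↦ by rw [causalPast_reverse]; exact hK₁' x
  have hrel₂' : ∀ {xs ys : ℕ → M₂} {x y : M₂}, Tendsto xs atTop (𝓝 x) → Tendsto ys atTop (𝓝 y) →
      (∀ j, ys j ∈ g₂.causalFuture τ₂.reverse {xs j}) → y ∈ g₂.causalFuture τ₂.reverse {x} := by
    intro xs ys x y hx hy h
    show y ∈ g₂.causalPast τ₂ {x}
    exact mem_causalPast_singleton_iff.2 (hrel₂ hy hx fun j ↦ mem_causalPast_singleton_iff.1 (h j))
  have hDsh'' : ∀ q ∈ g₂.chronologicalFuture τ₂.reverse S,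
      (∃ C : Set M₂, C ⊆ S ∧ IsCompact C ∧ g₂.chronologicalPast τ₂.reverse {q} ∩ S ⊆ C) →
      q ∈ W := by
    intro q hq hC
    refine hDsh' q hq ?_
    obtain ⟨C, hCS, hCc, hsh⟩ := hC
    refine ⟨C, hCS, hCc, ?_⟩
    rw [chronologicalPast_reverse] at hsh
    exact hsh
  exact false_of_corresponding_shadow_future (τ₁ := τ₁.reverse) (τ₂ := τ₂.reverse) hn₁ hn₂ hres₁
    hτ₁' hres₂ hτ₂' hS₁.reverse hS₁U hU' hA.reverse hW' hψW hWψ hψc hinj hopen hψS hpush' hpull'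
    hK₁'' hrel₂' hDsh'' hp hpI hcorr

/-- **Theorem: no corresponding boundary points, shadow form.** For any `p ∈ ∂U` (which lies in
`I⁺(S₁)` or in `I⁻(S₁)`) and any `p' ∈ M₂`, the pair `(p, p')` does not correspond, provided `W`
contains every point of `I⁺(S)` (resp. `I⁻(S)`) whose shadow `I⁻(q) ∩ S` (resp. `I⁺(q) ∩ S`) lies
in a compact subset of `S` — hypotheses (hDsh±), replacing the domain-of-dependence hypotheses
(hD±) and the horizon-lemma inputs of `false_of_corresponding`.
[cite: HawkingEllis1973CUP, §7.6, pp. 249–251] [cite: Sbierski2016AHP, §3.2, Def. 11 and Prop. 13 (arXiv numbering)] -/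
theorem false_of_corresponding_shadow (hn₁ : 2 ≤ n₁) (hn₂ : 2 ≤ n₂)
    (hres₁ : PseudoRiemannianMetric.contMDiff_restrict (I := I₁) (n := n₁) (M := M₁))
    (hτ₁ : τ₁.contMDiff_restrict)
    (hres₂ : PseudoRiemannianMetric.contMDiff_restrict (I := I₂) (n := n₂) (M := M₂))
    (hτ₂ : τ₂.contMDiff_restrict)
    {S₁ : Set M₁} (hS₁ : g₁.IsCauchyHypersurface τ₁ S₁) {U : Opens M₁} (hS₁U : S₁ ⊆ U)
    (hU : (g₁.restrict hres₁ U).IsCauchyHypersurface (τ₁.restrict hres₁ hτ₁ U) (Subtype.val ⁻¹' S₁))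
    {S : Set M₂} (hA : g₂.IsAchronal τ₂ S) {W : Opens M₂}
    (hW : (g₂.restrict hres₂ W).IsCauchyHypersurface (τ₂.restrict hres₂ hτ₂ W) (Subtype.val ⁻¹' S))
    {ψ : M₁ → M₂} (hψW : MapsTo ψ U W) (hWψ : (W : Set M₂) ⊆ ψ '' U) (hψc : ContinuousOn ψ U)
    (hinj : InjOn ψ U) (hopen : ∀ B : Set M₁, IsOpen B → IsOpen (ψ '' (B ∩ U)))
    (hψS : ψ '' S₁ = S)
    (hpush : ∀ ⦃γ : ℝ → M₁⦄ ⦃a b : ℝ⦄, a < b → g₁.IsFutureTimelikeCurveOn τ₁ γ (Icc a b) →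
      (∀ t ∈ Icc a b, γ t ∈ U) → ψ (γ b) ∈ g₂.chronologicalFuture τ₂ {ψ (γ a)})
    (hpull : ∀ ⦃γ : ℝ → M₂⦄ ⦃a b : ℝ⦄, a < b → g₂.IsFutureTimelikeCurveOn τ₂ γ (Icc a b) →
      (∀ t ∈ Icc a b, γ t ∈ W) → ∀ ⦃x y : M₁⦄, x ∈ U → y ∈ U → γ a = ψ x → γ b = ψ y →
      y ∈ g₁.chronologicalFuture τ₁ {x})
    (hK₁ : ∀ x : M₁, IsCompact (g₁.causalPast τ₁ {x} ∩ g₁.causalFuture τ₁ S₁))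
    (hK₁' : ∀ x : M₁, IsCompact (g₁.causalFuture τ₁ {x} ∩ g₁.causalPast τ₁ S₁))
    (hrel₂ : ∀ {xs ys : ℕ → M₂} {x y : M₂}, Tendsto xs atTop (𝓝 x) → Tendsto ys atTop (𝓝 y) →
      (∀ j, ys j ∈ g₂.causalFuture τ₂ {xs j}) → y ∈ g₂.causalFuture τ₂ {x})
    (hDsh : ∀ q ∈ g₂.chronologicalFuture τ₂ S,
      (∃ C : Set M₂, C ⊆ S ∧ IsCompact C ∧ g₂.chronologicalPast τ₂ {q} ∩ S ⊆ C) → q ∈ W)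
    (hDsh' : ∀ q ∈ g₂.chronologicalPast τ₂ S,
      (∃ C : Set M₂, C ⊆ S ∧ IsCompact C ∧ g₂.chronologicalFuture τ₂ {q} ∩ S ⊆ C) → q ∈ W)
    {p : M₁} (hp : p ∈ frontier (U : Set M₁)) {p' : M₂}
    (hcorr : ∀ V ∈ 𝓝 p, ∀ V' ∈ 𝓝 p', ∃ y ∈ (U : Set M₁), y ∈ V ∧ ψ y ∈ V') : False := by
  -- `p ∉ U ⊇ S₁`, so `p ∈ I⁺(S₁) ∪ I⁻(S₁)`
  have hpU : p ∉ (U : Set M₁) := fun h ↦ hp.2 (by rw [U.isOpen.interior_eq]; exact h)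
  have hpS : p ∉ S₁ := fun h ↦ hpU (hS₁U h)
  rcases hS₁.mem_chronologicalFuture_union_chronologicalPast hn₁ hpS with hpI | hpI
  · exact false_of_corresponding_shadow_future hn₁ hn₂ hres₁ hτ₁ hres₂ hτ₂ hS₁ hS₁U hU hA hW hψW
      hWψ hψc hinj hopen hψS hpush hpull hK₁ hrel₂ hDsh hp hpI hcorr
  · exact false_of_corresponding_shadow_past hn₁ hn₂ hres₁ hτ₁ hres₂ hτ₂ hS₁ hS₁U hU hA hW hψW
      hWψ hψc hinj hopen hψS hpush hpull hK₁' hrel₂ hDsh' hp hpI hcorr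

end Core

end LorentzianMetric

end Literature.Geometry.Lorentzian

end
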